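import Mathlib
import HarnessLib
import Literature.Analysis.FluidPDE.Tao2016AveragedNS.TaylorChainCertificate
import Summits.NavierStokesRegularity.NavierStokesRegularity.Theorems.TaylorModelRungThreeReadoutPackage
import Summits.NavierStokesRegularity.NavierStokesRegularity.Theorems.TaylorModelRungThreeGDefs
import Summits.NavierStokesRegularity.NavierStokesRegularity.Theorems.TaylorModelRungThreeReadoutG2Crossing

/-!
# Line `taylor-model` on crux K1b-DR (stmt-NavierStokesRegularity-23954) — stub G2 PROVED:
# `stub_crossing : Theorems.TaylorModel.CrossingReadouts` (BY NAME over `…TaylorModelRungThreeGDefs`, p598382)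

The registered stub G2 of the line (owner ns-idea-2 g3; skeleton of record sha16 `1e740af7f1414e3e`, v4.1/v4.2
texts), stated BY NAME over the tree definition `Theorems.TaylorModel.CrossingReadouts` of
`…TaylorModelRungThreeGDefs` (interface `IsWindowFlow`):

  `∀ cd φ, cd.Valid → IsWindowFlow cd φ → ChainEnclosure cd φ →
     Crossing cd φ (tauSel cd φ) ∧ KBlockE1 cd φ (tauSel cd φ)`.

Proof = `TaylorModelReadout.G2.crossingReadouts_core` (helpers `…ReadoutG2Sigma` p598319 and `…ReadoutG2Crossing`
p598891, which carry the whole argument: in the last sub-step the section value `t ↦ σf j (φ(q,t))` is continuous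
and strictly increasing — derivative `σf (Qb(φ,φ)) ≥ γ j > 0` by the transversality clause on the in-step
enclosure — below the level at node `S-1` and above it at node `S` by the node invariants and the two sign
clauses, so the crossing set is the closed interval `[τ, Tn S]` and `tauSel = sInf` is ATTAINED (critic P-TM5,
`G2.tauSel_spec`, exported for G3/G4 together with the uniqueness `G2.eq_tauSel_of_sigma_eq`); the (E1)
read-outs are the certificate's read-out clause at the crossing state, the ODE clause at `t = 0`, and the
window `M`-clause via the trivial κ-restart `G2.inBall_SpO_of_chain`).  The flow hypothesis `IsWindowFlow` is
not used: everything needed about `φ` is in `ChainEnclosure`.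

MODEL-lattice rung TL-M3 of the NS ladder only: nothing here is a statement about the Navier–Stokes equations;
K1b-DR itself is not proved by this file (stubs S1, K, G1, G3, G4 remain).
-/

-- the sub-problem namespace repeats the summit name by design (D-0017)
set_option linter.dupNamespace false

namespace Summit.NavierStokesRegularity.NavierStokesRegularity.Theorems.TaylorModel

/-- **Stub G2 of line `taylor-model`, by name.** For every valid Taylor-chain certificate, every window flow
`φ` and every chain enclosure of it, the crossing-time selector `tauSel cd φ` satisfies the internal crossing
facts `Crossing` and K1b-DR's (E1) read-out block `KBlockE1`. [folklore] -/
theorem stub_crossing : Summit.NavierStokesRegularity.NavierStokesRegularity.Theorems.TaylorModel.CrossingReadouts :=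
  fun _cd _φ hV _hW hC => TaylorModelReadout.G2.crossingReadouts_core hV hC

end Summit.NavierStokesRegularity.NavierStokesRegularity.Theorems.TaylorModel
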